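import Mathlib.Analysis.InnerProductSpace.Calculus
import Mathlib.Analysis.InnerProductSpace.PiL2
import Mathlib.Analysis.Calculus.FDeriv.Mul
import Mathlib.MeasureTheory.Constructions.HaarToSphere
import Mathlib.MeasureTheory.Measure.Lebesgue.VolumeOfBalls
import Mathlib.MeasureTheory.Integral.IntervalIntegral.FundThmCalculus
import Mathlib.Analysis.SpecialFunctions.Integrals.Basic
import Literature.Analysis.FluidPDE.VortexFilament.Profiles

/-!
# The capped, cut-off Newtonian kernel on `ℝ³`

Support file for the proof of the Jerrard–Seis energy lower bound
(`Literature.Analysis.FluidPDE.VortexFilament.JerrardSeis2016_filamentEnergyLowerBound`).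
The proof tests the flat-norm hypothesis of [JerrardSeis2016, Thm 1] against the field
`ξ = F ∗ μ_Γ`, where `F` is a smooth, compactly supported stand-in for the Newtonian potential
`G(z) = 1/(4π|z|)` mollified at scale `ε` (the paper's `Φ^ε = G ∗ ρ^ε ∗ μ_Γ`, §4.3): here
`F(z) = ε⁻¹ a(|z|²/ε²) b(|z|²/R²)` with the fixed profiles of `Profiles.lean`, so that
`F = 1/|z|` on `ε ≤ |z| ≤ R/2`, `F` is constant-order `ε⁻¹` inside `|z| ≤ ε` and vanishes for
`|z| ≥ R`.

## Contents

* Radial calculus on `EuclideanSpace ℝ (Fin 3)`: the chain rule for `z ↦ q(|z|²)`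
  (`hasFDerivAt_radial`), the product rule for `z ↦ 2 q₁(|z|²) z_j`
  (`hasFDerivAt_radial_mul_coord`), their evaluations on coordinate vectors, and polar
  integration `∫ f(|z|) dz = 4π ∫₀^∞ r² f(r) dr` (`integral_radial_fin_three`, from Mathlib's
  `integral_fun_norm_addHaar` and `volume_ball_fin_three`).
* `exists_kernel`: the kernel together with the radial profiles `q₁, q₂` of its first and second
  derivatives and ABSOLUTE constants `C₁, C₂, C₃` (independent of `ε, R`), with: support in
  `|z| ≤ R`; `0 ≤ F ≤ √2/max(ε,|z|)`; `F = 1/|z|` on the annulus; radial monotonicity;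
  `|∇F| ≤ 2C₁/max(ε,|z|)²`; the Laplacian `ΔF = 4q₂|z|² + 6q₁` is `O(ε⁻³)` on `|z| ≤ ε`,
  vanishes on `ε < |z| < R/2` (harmonicity of `1/|z|`) and for `|z| > R`, and is `O(R⁻³)` on
  `|z| ≥ R/2`; the flux identity `∫_{|z| ≤ ρ₁} ΔF = −4π` (`ε < ρ₁ < R/2`; Gauss' law for the
  point charge, computed in polar coordinates via `d/dr (2 r³ q₁(r²)) = r² ΔF`); and
  `∫ F ≤ 2√2 π R²`.

No definitions are introduced (the kernel is packaged existentially). [folklore]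
-/

noncomputable section

open MeasureTheory Set Filter Real Metric Module
open scoped Topology InnerProductSpace RealInnerProductSpace

namespace Literature.Analysis.FluidPDE

namespace VortexFilament

/-! ### Radial calculus on `ℝ³` -/

/-- Chain rule for a radial function `z ↦ q(‖z‖²)`. [folklore] -/
theorem hasFDerivAt_radial {q : ℝ → ℝ} {q' : ℝ} {z : EuclideanSpace ℝ (Fin 3)}
    (hq : HasDerivAt q q' (‖z‖ ^ 2)) :
    HasFDerivAt (fun w : EuclideanSpace ℝ (Fin 3) => q (‖w‖ ^ 2)) ((2 * q') • innerSL ℝ z) z := by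
  have h : HasFDerivAt (fun w : EuclideanSpace ℝ (Fin 3) => q (‖w‖ ^ 2))
      (q' • ((2:ℕ) • innerSL ℝ z)) z :=
    hq.comp_hasFDerivAt z (hasStrictFDerivAt_norm_sq z).hasFDerivAt
  refine h.congr_fderiv ?_
  ext v
  simp only [FunLike.coe_smul, Pi.smul_apply, smul_eq_mul, two_smul, add_apply]
  ring

/-- The coordinate function `w ↦ w_j` has derivative `⟪e_j, ·⟫`. [folklore] -/
theorem hasFDerivAt_coord (j : Fin 3) (z : EuclideanSpace ℝ (Fin 3)) :
    HasFDerivAt (fun w : EuclideanSpace ℝ (Fin 3) => w j)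
      (innerSL ℝ (EuclideanSpace.single j (1:ℝ))) z := by
  have hfun : (fun w : EuclideanSpace ℝ (Fin 3) => w j) =
      fun w => (innerSL ℝ (EuclideanSpace.single j (1:ℝ))) w := by
    funext w; simp [EuclideanSpace.inner_single_left]
  rw [hfun]; exact (innerSL ℝ _).hasFDerivAt

/-- Product rule for `z ↦ 2 q₁(‖z‖²) z_j`. [folklore] -/
theorem hasFDerivAt_radial_mul_coord {q₁ : ℝ → ℝ} {q₂ : ℝ} {z : EuclideanSpace ℝ (Fin 3)}
    (hq : HasDerivAt q₁ q₂ (‖z‖ ^ 2)) (j : Fin 3) :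
    HasFDerivAt (fun w : EuclideanSpace ℝ (Fin 3) => 2 * q₁ (‖w‖ ^ 2) * w j)
      ((2 * q₁ (‖z‖ ^ 2)) • innerSL ℝ (EuclideanSpace.single j (1:ℝ)) +
        (z j) • ((4 * q₂) • innerSL ℝ z)) z := by
  have h1 : HasFDerivAt (fun w : EuclideanSpace ℝ (Fin 3) => 2 * q₁ (‖w‖ ^ 2))
      ((2 * (2 * q₂)) • innerSL ℝ z) z := hasFDerivAt_radial (hq.const_mul 2)
  refine (h1.mul (hasFDerivAt_coord j z)).congr_fderiv ?_
  ext v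
  simp only [add_apply, FunLike.coe_smul, Pi.smul_apply, smul_eq_mul, innerSL_apply_apply,
    EuclideanSpace.inner_single_left, map_one, one_mul]
  ring

/-- Evaluation of the radial derivative on a coordinate vector: `∂_j q(‖z‖²) = 2 q' z_j`.
[folklore] -/
theorem radial_fderiv_apply_single {q' : ℝ} (z : EuclideanSpace ℝ (Fin 3)) (j : Fin 3) :
    ((2 * q') • innerSL ℝ z) (EuclideanSpace.single j 1) = 2 * q' * z j := by
  simp [EuclideanSpace.inner_single_right]

/-- Evaluation of the second radial derivative on coordinate vectors:
`∂_i (2 q₁ z_j) = 4 q₂ z_i z_j + 2 q₁ δ_ij`. [folklore] -/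
theorem radial_fderiv2_apply_single {c q₂ : ℝ} (z : EuclideanSpace ℝ (Fin 3)) (i j : Fin 3) :
    (c • innerSL ℝ (EuclideanSpace.single j (1:ℝ)) + (z j) • ((4 * q₂) • innerSL ℝ z))
        (EuclideanSpace.single i (1:ℝ)) =
      4 * q₂ * z i * z j + (if i = j then c else 0) := by
  simp [EuclideanSpace.inner_single_right, PiLp.single_apply]
  ring

/-- Volume of the unit ball of `ℝ³` as a real number. [folklore] -/
theorem volume_real_ball_fin_three :
    (volume : Measure (EuclideanSpace ℝ (Fin 3))).real (ball 0 1) = π * 4 / 3 := by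
  rw [measureReal_def, EuclideanSpace.volume_ball_fin_three]
  simp [ENNReal.toReal_ofReal (by positivity : (0:ℝ) ≤ π * 4 / 3)]

/-- Polar integration of a radial function on `ℝ³`: `∫ f(‖z‖) dz = 4π ∫₀^∞ r² f(r) dr`.
[folklore] -/
theorem integral_radial_fin_three (f : ℝ → ℝ) :
    ∫ z : EuclideanSpace ℝ (Fin 3), f ‖z‖ = 4 * π * ∫ r in Ioi (0:ℝ), r ^ 2 * f r := by
  have h := integral_fun_norm_addHaar (volume : Measure (EuclideanSpace ℝ (Fin 3))) f
  rw [h, volume_real_ball_fin_three, finrank_euclideanSpace_fin]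
  simp only [smul_eq_mul, nsmul_eq_mul, Nat.cast_ofNat]
  have : (3 - 1 : ℕ) = 2 := by norm_num
  simp only [this]
  ring

/-! ### The kernel -/
set_option maxHeartbeats 400000 in -- buildfix (bf3-g26): 160k/180k FAIL, 200k PASS at accept time; line-neutral budget line
/-- **The capped, cut-off Newtonian kernel.** There are absolute constants `C₁, C₂, C₃` such that
for all scales `0 < ε`, `2ε < R` there is a `C²` radial function `F : ℝ³ → ℝ` — namely
`F(z) = ε⁻¹ a(|z|²/ε²) b(|z|²/R²)` with the profiles of `exists_profileA`, `exists_profileB` —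
together with the radial profiles `q₁, q₂` of its first and second derivatives
(`∇F(z) = 2 q₁(|z|²) z`, `∂ᵢ(2 q₁(|z|²) z_j) = 4 q₂(|z|²) zᵢ z_j + 2 q₁(|z|²) δᵢⱼ`, so that
`ΔF(z) = 4 q₂(|z|²)|z|² + 6 q₁(|z|²)`), satisfying: `F` vanishes for `|z| ≥ R`;
`0 ≤ F(z) ≤ √2 / max(ε, |z|)`; `F(z) = 1/|z|` for `ε ≤ |z| ≤ R/2`; `F` is radially
non-increasing; `|q₁(|z|²)| |z| ≤ C₁ / max(ε,|z|)²` (so `|∇F| ≤ 2C₁/max(ε,|z|)²`);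
`|ΔF| ≤ C₂ ε⁻³` on `|z| ≤ ε`, `ΔF = 0` on `ε < |z| < R/2` (harmonicity of `1/|z|`),
`|ΔF| ≤ C₃ R⁻³` on `|z| ≥ R/2`, `ΔF = 0` for `|z| > R`; the **flux identity**
`∫_{|z| ≤ ρ₁} ΔF = −4π` for every `ε < ρ₁ < R/2` (Gauss: the flux of `∇(1/|z|)` through a sphere
is `−4π`; computed in polar coordinates); and `∫ F ≤ 2√2 π R²`. This is an explicit smooth
stand-in for the mollified Newtonian potential `G ∗ ρ^ε` of [JerrardSeis2016, §4.3]. [folklore] -/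
theorem exists_kernel : ∃ C₁ C₂ C₃ : ℝ, 0 ≤ C₁ ∧ 0 ≤ C₂ ∧ 0 ≤ C₃ ∧
    ∀ ε R : ℝ, 0 < ε → 2 * ε < R →
    ∃ (F : EuclideanSpace ℝ (Fin 3) → ℝ) (q₁ q₂ : ℝ → ℝ),
      ContDiff ℝ 2 F ∧ Continuous q₁ ∧ Continuous q₂ ∧
      (∀ z : EuclideanSpace ℝ (Fin 3), R ≤ ‖z‖ → F z = 0) ∧
      (∀ z : EuclideanSpace ℝ (Fin 3), 0 ≤ F z) ∧
      (∀ z : EuclideanSpace ℝ (Fin 3), F z ≤ Real.sqrt 2 * (max ε ‖z‖)⁻¹) ∧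
      (∀ z : EuclideanSpace ℝ (Fin 3), ε ≤ ‖z‖ → ‖z‖ ≤ R / 2 → F z = ‖z‖⁻¹) ∧
      (∀ z w : EuclideanSpace ℝ (Fin 3), ‖z‖ ≤ ‖w‖ → F w ≤ F z) ∧
      (∀ z : EuclideanSpace ℝ (Fin 3), HasFDerivAt F ((2 * q₁ (‖z‖ ^ 2)) • innerSL ℝ z) z) ∧
      (∀ (z : EuclideanSpace ℝ (Fin 3)) (j : Fin 3),
        HasFDerivAt (fun w : EuclideanSpace ℝ (Fin 3) => 2 * q₁ (‖w‖ ^ 2) * w j)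
        ((2 * q₁ (‖z‖ ^ 2)) • innerSL ℝ (EuclideanSpace.single j (1:ℝ)) +
          (z j) • ((4 * q₂ (‖z‖ ^ 2)) • innerSL ℝ z)) z) ∧
      (∀ z : EuclideanSpace ℝ (Fin 3), |q₁ (‖z‖ ^ 2)| * ‖z‖ ≤ C₁ * ((max ε ‖z‖)⁻¹) ^ 2) ∧
      (∀ z : EuclideanSpace ℝ (Fin 3), ‖z‖ ≤ ε →
        |4 * q₂ (‖z‖ ^ 2) * ‖z‖ ^ 2 + 6 * q₁ (‖z‖ ^ 2)| ≤ C₂ * ε⁻¹ ^ 3) ∧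
      (∀ z : EuclideanSpace ℝ (Fin 3), ε < ‖z‖ → ‖z‖ < R / 2 →
        4 * q₂ (‖z‖ ^ 2) * ‖z‖ ^ 2 + 6 * q₁ (‖z‖ ^ 2) = 0) ∧
      (∀ z : EuclideanSpace ℝ (Fin 3), R / 2 ≤ ‖z‖ →
        |4 * q₂ (‖z‖ ^ 2) * ‖z‖ ^ 2 + 6 * q₁ (‖z‖ ^ 2)| ≤ C₃ * R⁻¹ ^ 3) ∧
      (∀ z : EuclideanSpace ℝ (Fin 3), R < ‖z‖ →
        4 * q₂ (‖z‖ ^ 2) * ‖z‖ ^ 2 + 6 * q₁ (‖z‖ ^ 2) = 0) ∧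
      (∀ ρ₁ : ℝ, ε < ρ₁ → ρ₁ < R / 2 →
        ∫ z in closedBall (0 : EuclideanSpace ℝ (Fin 3)) ρ₁,
          (4 * q₂ (‖z‖ ^ 2) * ‖z‖ ^ 2 + 6 * q₁ (‖z‖ ^ 2)) = -4 * π) ∧
      Integrable F ∧ (∫ z, F z ≤ 2 * Real.sqrt 2 * π * R ^ 2) := by
  obtain ⟨a, ha_smooth, ha_anti, ha_pos, ha_le, ha_sq, ha_d1, ha_d2, ⟨A₁, hA₁0, hA₁⟩,
    ⟨A₂, hA₂0, hA₂⟩⟩ := exists_profileA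
  obtain ⟨b, hb_smooth, hb_anti, hb_nonneg, hb_le, hb_quarter, hb_one, hb_d1, hb_d2,
    ⟨B₁, hB₁0, hB₁⟩, ⟨B₂, hB₂0, hB₂⟩⟩ := exists_profileB
  refine ⟨max A₁ (1 / 2 + B₁), 4 * A₂ + 6 * A₁, 4 * B₁ + 4 * B₂,
    le_max_of_le_right (by positivity), by positivity, by positivity, ?_⟩
  intro ε R hε hR
  have hR0 : 0 < R := by linarith
  -- the one-variable profile of the kernel and of its derivatives
  set q : ℝ → ℝ := fun t => ε⁻¹ * a (t / ε ^ 2) * b (t / R ^ 2) with hq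
  set q₁ : ℝ → ℝ := fun t => ε⁻¹ * (deriv a (t / ε ^ 2) * (ε ^ 2)⁻¹ * b (t / R ^ 2) +
    a (t / ε ^ 2) * (deriv b (t / R ^ 2) * (R ^ 2)⁻¹)) with hq₁
  set q₂ : ℝ → ℝ := fun t => ε⁻¹ * (deriv (deriv a) (t / ε ^ 2) * (ε ^ 2)⁻¹ * (ε ^ 2)⁻¹ *
      b (t / R ^ 2) + 2 * (deriv a (t / ε ^ 2) * (ε ^ 2)⁻¹) * (deriv b (t / R ^ 2) * (R ^ 2)⁻¹) +
    a (t / ε ^ 2) * (deriv (deriv b) (t / R ^ 2) * (R ^ 2)⁻¹ * (R ^ 2)⁻¹)) with hq₂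
  set F : EuclideanSpace ℝ (Fin 3) → ℝ := fun z => q (‖z‖ ^ 2) with hF
  -- one-variable calculus
  have hda := hasDerivAt_of_contDiff_two ha_smooth
  have hdda := hasDerivAt_deriv_of_contDiff_two ha_smooth
  have hdb := hasDerivAt_of_contDiff_two hb_smooth
  have hddb := hasDerivAt_deriv_of_contDiff_two hb_smooth
  have h1 : ∀ t, HasDerivAt (fun t => a (t / ε ^ 2)) (deriv a (t / ε ^ 2) * (ε ^ 2)⁻¹) t := by
    intro t
    have h := (hda (t / ε ^ 2)).comp t ((hasDerivAt_id t).div_const (ε ^ 2))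
    exact h.congr_deriv (by simp [div_eq_mul_inv])
  have h1' : ∀ t, HasDerivAt (fun t => deriv a (t / ε ^ 2))
      (deriv (deriv a) (t / ε ^ 2) * (ε ^ 2)⁻¹) t := by
    intro t
    have h := (hdda (t / ε ^ 2)).comp t ((hasDerivAt_id t).div_const (ε ^ 2))
    exact h.congr_deriv (by simp [div_eq_mul_inv])
  have h2 : ∀ t, HasDerivAt (fun t => b (t / R ^ 2)) (deriv b (t / R ^ 2) * (R ^ 2)⁻¹) t := by
    intro t
    have h := (hdb (t / R ^ 2)).comp t ((hasDerivAt_id t).div_const (R ^ 2))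
    exact h.congr_deriv (by simp [div_eq_mul_inv])
  have h2' : ∀ t, HasDerivAt (fun t => deriv b (t / R ^ 2))
      (deriv (deriv b) (t / R ^ 2) * (R ^ 2)⁻¹) t := by
    intro t
    have h := (hddb (t / R ^ 2)).comp t ((hasDerivAt_id t).div_const (R ^ 2))
    exact h.congr_deriv (by simp [div_eq_mul_inv])
  have hq_deriv : ∀ t, HasDerivAt q (q₁ t) t := by
    intro t
    refine (((h1 t).const_mul ε⁻¹).mul (h2 t)).congr_deriv ?_
    simp only [hq₁]
    ring
  have hq₁_deriv : ∀ t, HasDerivAt q₁ (q₂ t) t := by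
    intro t
    refine (((((h1' t).mul_const (ε ^ 2)⁻¹).mul (h2 t)).add
      ((h1 t).mul ((h2' t).mul_const (R ^ 2)⁻¹))).const_mul ε⁻¹).congr_deriv ?_
    simp only [hq₂]
    ring
  have hq_cont : ContDiff ℝ 2 q := by
    simp only [hq]
    refine (contDiff_const.mul (ha_smooth.comp (contDiff_id.div_const _))).mul
      (hb_smooth.comp (contDiff_id.div_const _))
  have hq₁_cont : Continuous q₁ := by
    have hca := continuous_deriv_of_contDiff_two ha_smooth
    have hcb := continuous_deriv_of_contDiff_two hb_smooth
    simp only [hq₁]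
    fun_prop
  have hq₂_cont : Continuous q₂ := by
    have hca := continuous_deriv_of_contDiff_two ha_smooth
    have hcb := continuous_deriv_of_contDiff_two hb_smooth
    have hcca := continuous_deriv2_of_contDiff_two ha_smooth
    have hccb := continuous_deriv2_of_contDiff_two hb_smooth
    have hcona := ha_smooth.continuous
    have hconb := hb_smooth.continuous
    simp only [hq₂]
    fun_prop
  -- region facts, parametrised by the radius `r = ‖z‖`
  have hb_in : ∀ r : ℝ, 0 ≤ r → r < R / 2 →
      b (r ^ 2 / R ^ 2) = 1 ∧ deriv b (r ^ 2 / R ^ 2) = 0 ∧ deriv (deriv b) (r ^ 2 / R ^ 2) = 0 := by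
    intro r hr0 hr
    have hlt : r ^ 2 / R ^ 2 < 1 / 4 := by
      rw [div_lt_iff₀ (by positivity)]; nlinarith
    exact ⟨hb_quarter _ hlt.le, hb_d1 _ (Or.inl hlt), hb_d2 _ (Or.inl hlt)⟩
  have hb_small : ∀ r : ℝ, 0 ≤ r → r ≤ R / 2 → b (r ^ 2 / R ^ 2) = 1 := by
    intro r hr0 hr
    apply hb_quarter
    rw [div_le_iff₀ (by positivity)]; nlinarith
  have hb_out : ∀ r : ℝ, R ≤ r → b (r ^ 2 / R ^ 2) = 0 := by
    intro r hr
    apply hb_one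
    rw [le_div_iff₀ (by positivity)]; nlinarith
  have hb_out' : ∀ r : ℝ, R < r → deriv b (r ^ 2 / R ^ 2) = 0 ∧ deriv (deriv b) (r ^ 2 / R ^ 2) = 0 := by
    intro r hr
    have hlt : 1 < r ^ 2 / R ^ 2 := by
      rw [lt_div_iff₀ (by positivity)]; nlinarith
    exact ⟨hb_d1 _ (Or.inr hlt), hb_d2 _ (Or.inr hlt)⟩
  have ha_out : ∀ r : ℝ, ε < r →
      ε⁻¹ * a (r ^ 2 / ε ^ 2) = r⁻¹ ∧
      ε⁻¹ * (deriv a (r ^ 2 / ε ^ 2) * (ε ^ 2)⁻¹) = -1 / (2 * r ^ 3) ∧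
      ε⁻¹ * (deriv (deriv a) (r ^ 2 / ε ^ 2) * (ε ^ 2)⁻¹ * (ε ^ 2)⁻¹) = 3 / (4 * r ^ 5) := by
    intro r hr
    have hr0 : 0 < r := hε.trans hr
    have hs : 1 < r / ε := (one_lt_div hε).2 hr
    have hτ : r ^ 2 / ε ^ 2 = (r / ε) ^ 2 := by ring
    rw [hτ, ha_sq _ hs.le, ha_d1 _ hs, ha_d2 _ hs]
    refine ⟨?_, ?_, ?_⟩
    · field_simp
    · field_simp
    · field_simp
  have ha_in : ∀ r : ℝ, 0 ≤ r → r ≤ ε → r ^ 2 / ε ^ 2 ∈ Icc (0:ℝ) 1 := by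
    intro r hr0 hr
    refine ⟨by positivity, ?_⟩
    rw [div_le_iff₀ (by positivity)]; nlinarith
  have ha_out0 : ∀ r : ℝ, ε ≤ r → ε⁻¹ * a (r ^ 2 / ε ^ 2) = r⁻¹ := by
    intro r hr
    have hr0 : 0 < r := hε.trans_le hr
    have hs : 1 ≤ r / ε := (one_le_div hε).2 hr
    have hτ : r ^ 2 / ε ^ 2 = (r / ε) ^ 2 := by ring
    rw [hτ, ha_sq _ hs]
    field_simp
  -- closed forms of `q`, `q₁`, `q₂`, `lap` at radius `r`
  have hq_in : ∀ r : ℝ, 0 ≤ r → r ≤ ε → q (r ^ 2) = ε⁻¹ * a (r ^ 2 / ε ^ 2) := by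
    intro r hr0 hr
    have hb1 := hb_small r hr0 (by linarith)
    simp only [hq, hb1, mul_one]
  have hq₁_in : ∀ r : ℝ, 0 ≤ r → r ≤ ε →
      q₁ (r ^ 2) = ε⁻¹ * (ε ^ 2)⁻¹ * deriv a (r ^ 2 / ε ^ 2) := by
    intro r hr0 hr
    obtain ⟨hb1, hb2, -⟩ := hb_in r hr0 (by linarith)
    simp only [hq₁, hb1, hb2]; ring
  have hq₂_in : ∀ r : ℝ, 0 ≤ r → r ≤ ε →
      q₂ (r ^ 2) = ε⁻¹ * (ε ^ 2)⁻¹ * (ε ^ 2)⁻¹ * deriv (deriv a) (r ^ 2 / ε ^ 2) := by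
    intro r hr0 hr
    obtain ⟨hb1, hb2, hb3⟩ := hb_in r hr0 (by linarith)
    simp only [hq₂, hb1, hb2, hb3]; ring
  have hq_out : ∀ r : ℝ, ε ≤ r → q (r ^ 2) = r⁻¹ * b (r ^ 2 / R ^ 2) := by
    intro r hr
    simp only [hq]
    rw [ha_out0 r hr]
  have hq₁_out : ∀ r : ℝ, ε < r → q₁ (r ^ 2) =
      -1 / (2 * r ^ 3) * b (r ^ 2 / R ^ 2) + r⁻¹ * (deriv b (r ^ 2 / R ^ 2) * (R ^ 2)⁻¹) := by
    intro r hr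
    obtain ⟨h0, h1, -⟩ := ha_out r hr
    have : q₁ (r ^ 2) = ε⁻¹ * (deriv a (r ^ 2 / ε ^ 2) * (ε ^ 2)⁻¹) * b (r ^ 2 / R ^ 2) +
        ε⁻¹ * a (r ^ 2 / ε ^ 2) * (deriv b (r ^ 2 / R ^ 2) * (R ^ 2)⁻¹) := by
      simp only [hq₁]; ring
    rw [this, h0, h1]
  have hq₂_out : ∀ r : ℝ, ε < r → q₂ (r ^ 2) =
      3 / (4 * r ^ 5) * b (r ^ 2 / R ^ 2) +
      2 * (-1 / (2 * r ^ 3)) * (deriv b (r ^ 2 / R ^ 2) * (R ^ 2)⁻¹) +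
      r⁻¹ * (deriv (deriv b) (r ^ 2 / R ^ 2) * (R ^ 2)⁻¹ * (R ^ 2)⁻¹) := by
    intro r hr
    obtain ⟨h0, h1, h2⟩ := ha_out r hr
    have : q₂ (r ^ 2) =
        ε⁻¹ * (deriv (deriv a) (r ^ 2 / ε ^ 2) * (ε ^ 2)⁻¹ * (ε ^ 2)⁻¹) * b (r ^ 2 / R ^ 2) +
        2 * (ε⁻¹ * (deriv a (r ^ 2 / ε ^ 2) * (ε ^ 2)⁻¹)) * (deriv b (r ^ 2 / R ^ 2) * (R ^ 2)⁻¹) +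
        ε⁻¹ * a (r ^ 2 / ε ^ 2) * (deriv (deriv b) (r ^ 2 / R ^ 2) * (R ^ 2)⁻¹ * (R ^ 2)⁻¹) := by
      simp only [hq₂]; ring
    rw [this, h0, h1, h2]
  have hlap_out : ∀ r : ℝ, ε < r → 4 * q₂ (r ^ 2) * r ^ 2 + 6 * q₁ (r ^ 2) =
      2 * deriv b (r ^ 2 / R ^ 2) / (r * R ^ 2) +
        4 * r * deriv (deriv b) (r ^ 2 / R ^ 2) / R ^ 4 := by
    intro r hr
    have hr0 : 0 < r := hε.trans hr
    rw [hq₁_out r hr, hq₂_out r hr]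
    field_simp
    ring
  have hlap_far : ∀ r : ℝ, R < r → 4 * q₂ (r ^ 2) * r ^ 2 + 6 * q₁ (r ^ 2) = 0 := by
    intro r hr
    obtain ⟨h1, h2⟩ := hb_out' r hr
    rw [hlap_out r (by linarith), h1, h2]; simp
  -- continuity / support of the kernel
  have hF_cont : Continuous F := hq_cont.continuous.comp (continuous_norm.pow 2)
  have hF_zero : ∀ z : EuclideanSpace ℝ (Fin 3), R ≤ ‖z‖ → F z = 0 := by
    intro z hz
    show q (‖z‖ ^ 2) = 0
    simp only [hq, hb_out ‖z‖ hz, mul_zero]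
  have hF_supp : HasCompactSupport F := by
    refine HasCompactSupport.intro (isCompact_closedBall (0 : EuclideanSpace ℝ (Fin 3)) R) ?_
    intro z hz
    rw [mem_closedBall_zero_iff, not_le] at hz
    exact hF_zero z hz.le
  have hF_int : Integrable F := hF_cont.integrable_of_hasCompactSupport hF_supp
  have hF_nonneg : ∀ z : EuclideanSpace ℝ (Fin 3), 0 ≤ F z := fun z =>
    mul_nonneg (mul_nonneg (inv_nonneg.2 hε.le) (ha_pos _).le) (hb_nonneg _)
  have hF_le : ∀ z : EuclideanSpace ℝ (Fin 3), F z ≤ Real.sqrt 2 * (max ε ‖z‖)⁻¹ := by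
    intro z
    show q (‖z‖ ^ 2) ≤ _
    rcases le_or_gt ‖z‖ ε with h | h
    · rw [hq_in ‖z‖ (norm_nonneg _) h, max_eq_left h]
      calc ε⁻¹ * a (‖z‖ ^ 2 / ε ^ 2) ≤ ε⁻¹ * Real.sqrt 2 :=
            mul_le_mul_of_nonneg_left (ha_le _) (inv_nonneg.2 hε.le)
        _ = Real.sqrt 2 * ε⁻¹ := mul_comm _ _
    · rw [hq_out ‖z‖ h.le, max_eq_right h.le]
      have hr0 : 0 < ‖z‖ := hε.trans h
      calc ‖z‖⁻¹ * b (‖z‖ ^ 2 / R ^ 2) ≤ ‖z‖⁻¹ * 1 :=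
            mul_le_mul_of_nonneg_left (hb_le _) (inv_nonneg.2 hr0.le)
        _ ≤ Real.sqrt 2 * ‖z‖⁻¹ := by
            rw [mul_one]
            have h1 : (1:ℝ) ≤ Real.sqrt 2 := by
              rw [show (1:ℝ) = Real.sqrt 1 by simp]
              exact Real.sqrt_le_sqrt (by norm_num)
            nlinarith [inv_nonneg.2 hr0.le]
  refine ⟨F, q₁, q₂, hq_cont.comp (contDiff_norm_sq ℝ), hq₁_cont, hq₂_cont, hF_zero, hF_nonneg,
    hF_le, ?_, ?_, fun z => hasFDerivAt_radial (hq_deriv _),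
    fun z j => hasFDerivAt_radial_mul_coord (hq₁_deriv _) j, ?_, ?_, ?_, ?_, ?_, ?_, hF_int, ?_⟩
  · -- `F = 1/|z|` on the annulus
    intro z h1 h2
    show q (‖z‖ ^ 2) = ‖z‖⁻¹
    rw [hq_out ‖z‖ h1, hb_small ‖z‖ (norm_nonneg _) h2, mul_one]
  · -- radially non-increasing
    intro z w hzw
    show q (‖w‖ ^ 2) ≤ q (‖z‖ ^ 2)
    simp only [hq]
    have h1 : a (‖w‖ ^ 2 / ε ^ 2) ≤ a (‖z‖ ^ 2 / ε ^ 2) := by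
      apply ha_anti; gcongr
    have h2 : b (‖w‖ ^ 2 / R ^ 2) ≤ b (‖z‖ ^ 2 / R ^ 2) := by
      apply hb_anti; gcongr
    have h3 : 0 ≤ ε⁻¹ * a (‖z‖ ^ 2 / ε ^ 2) := mul_nonneg (inv_nonneg.2 hε.le) (ha_pos _).le
    calc ε⁻¹ * a (‖w‖ ^ 2 / ε ^ 2) * b (‖w‖ ^ 2 / R ^ 2)
        ≤ ε⁻¹ * a (‖z‖ ^ 2 / ε ^ 2) * b (‖w‖ ^ 2 / R ^ 2) := by
          apply mul_le_mul_of_nonneg_right _ (hb_nonneg _)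
          exact mul_le_mul_of_nonneg_left h1 (inv_nonneg.2 hε.le)
      _ ≤ ε⁻¹ * a (‖z‖ ^ 2 / ε ^ 2) * b (‖z‖ ^ 2 / R ^ 2) :=
          mul_le_mul_of_nonneg_left h2 h3
  · -- gradient bound
    intro z
    set r := ‖z‖ with hr
    have hr0 : 0 ≤ r := norm_nonneg _
    rcases le_or_gt r ε with h | h
    · rw [max_eq_left h, hq₁_in r hr0 h]
      have hA := hA₁ _ (ha_in r hr0 h)
      rw [abs_le] at hA
      have hε3 : 0 < ε⁻¹ * (ε ^ 2)⁻¹ := by positivity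
      calc |ε⁻¹ * (ε ^ 2)⁻¹ * deriv a (r ^ 2 / ε ^ 2)| * r
          = ε⁻¹ * (ε ^ 2)⁻¹ * |deriv a (r ^ 2 / ε ^ 2)| * r := by
            rw [abs_mul, abs_of_pos hε3]
        _ ≤ ε⁻¹ * (ε ^ 2)⁻¹ * A₁ * ε := by gcongr; exact abs_le.2 hA
        _ = A₁ * ε⁻¹ ^ 2 := by field_simp
        _ ≤ max A₁ (1 / 2 + B₁) * ε⁻¹ ^ 2 := by gcongr; exact le_max_left _ _
    · rw [max_eq_right h.le]
      have hr0' : 0 < r := hε.trans h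
      rcases le_or_gt r R with h' | h'
      · rw [hq₁_out r h]
        have hb0 := hb_nonneg (r ^ 2 / R ^ 2)
        have hb1 := hb_le (r ^ 2 / R ^ 2)
        have hb2 := hB₁ (r ^ 2 / R ^ 2)
        rw [abs_le] at hb2
        have hRr : (R ^ 2)⁻¹ ≤ (r ^ 2)⁻¹ := by
          apply inv_anti₀ (by positivity); gcongr
        calc |-1 / (2 * r ^ 3) * b (r ^ 2 / R ^ 2) + r⁻¹ * (deriv b (r ^ 2 / R ^ 2) * (R ^ 2)⁻¹)| * r
            ≤ (1 / (2 * r ^ 3) * 1 + r⁻¹ * (B₁ * (R ^ 2)⁻¹)) * r := by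
              apply mul_le_mul_of_nonneg_right _ hr0
              refine (abs_add_le _ _).trans (add_le_add ?_ ?_)
              · rw [abs_mul, abs_of_nonneg hb0, abs_div, abs_neg, abs_one,
                  abs_of_pos (by positivity : (0:ℝ) < 2 * r ^ 3)]
                exact mul_le_mul_of_nonneg_left hb1 (by positivity)
              · rw [abs_mul, abs_of_pos (inv_pos.2 hr0'), abs_mul,
                  abs_of_pos (inv_pos.2 (by positivity : (0:ℝ) < R ^ 2))]
                gcongr; exact abs_le.2 hb2
          _ ≤ (1 / (2 * r ^ 3) * 1 + r⁻¹ * (B₁ * (r ^ 2)⁻¹)) * r := by gcongr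
          _ = (1 / 2 + B₁) * r⁻¹ ^ 2 := by field_simp
          _ ≤ max A₁ (1 / 2 + B₁) * r⁻¹ ^ 2 := by gcongr; exact le_max_right _ _
      · rw [hq₁_out r h, hb_out r h'.le, (hb_out' r h').1]
        simp only [mul_zero, zero_mul, mul_zero, add_zero, abs_zero, zero_mul]
        positivity
  · -- Laplacian bound on the inner ball
    intro z hz
    set r := ‖z‖ with hr
    have hr0 : 0 ≤ r := norm_nonneg _
    rw [hq₁_in r hr0 hz, hq₂_in r hr0 hz]
    have hA := abs_le.1 (hA₁ _ (ha_in r hr0 hz))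
    have hA' := abs_le.1 (hA₂ _ (ha_in r hr0 hz))
    have hr2 : r ^ 2 ≤ ε ^ 2 := by gcongr
    have e1 : 0 < ε⁻¹ := inv_pos.2 hε
    have e2 : 0 < (ε ^ 2)⁻¹ := by positivity
    calc |4 * (ε⁻¹ * (ε ^ 2)⁻¹ * (ε ^ 2)⁻¹ * deriv (deriv a) (r ^ 2 / ε ^ 2)) * r ^ 2 +
          6 * (ε⁻¹ * (ε ^ 2)⁻¹ * deriv a (r ^ 2 / ε ^ 2))|
        ≤ 4 * (ε⁻¹ * (ε ^ 2)⁻¹ * (ε ^ 2)⁻¹ * A₂) * ε ^ 2 + 6 * (ε⁻¹ * (ε ^ 2)⁻¹ * A₁) := by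
          refine (abs_add_le _ _).trans (add_le_add ?_ ?_)
          · rw [abs_mul, abs_mul, abs_of_pos (by norm_num : (0:ℝ) < 4), abs_mul,
              abs_of_pos (by positivity : (0:ℝ) < ε⁻¹ * (ε ^ 2)⁻¹ * (ε ^ 2)⁻¹),
              abs_of_nonneg (by positivity : (0:ℝ) ≤ r ^ 2)]
            gcongr; exact abs_le.2 hA'
          · rw [abs_mul, abs_mul, abs_of_pos (by norm_num : (0:ℝ) < 6),
              abs_of_pos (by positivity : (0:ℝ) < ε⁻¹ * (ε ^ 2)⁻¹)]
            gcongr; exact abs_le.2 hA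
      _ = (4 * A₂ + 6 * A₁) * ε⁻¹ ^ 3 := by field_simp
  · -- harmonic in between
    intro z h1 h2
    set r := ‖z‖ with hr
    have hr0 : 0 < r := hε.trans h1
    obtain ⟨-, hb2, hb3⟩ := hb_in r hr0.le h2
    rw [hlap_out r h1, hb2, hb3]; simp
  · -- Laplacian bound on the outer shell
    intro z hz
    set r := ‖z‖ with hr
    have hr0 : 0 < r := by linarith
    have hεr : ε < r := by linarith
    rcases le_or_gt r R with h' | h'
    · rw [hlap_out r hεr]
      have hb2 := abs_le.1 (hB₁ (r ^ 2 / R ^ 2))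
      have hb3 := abs_le.1 (hB₂ (r ^ 2 / R ^ 2))
      calc |2 * deriv b (r ^ 2 / R ^ 2) / (r * R ^ 2) + 4 * r * deriv (deriv b) (r ^ 2 / R ^ 2) / R ^ 4|
          ≤ 2 * B₁ / (R / 2 * R ^ 2) + 4 * R * B₂ / R ^ 4 := by
            refine (abs_add_le _ _).trans (add_le_add ?_ ?_)
            · rw [abs_div, abs_mul, abs_of_pos (by norm_num : (0:ℝ) < 2),
                abs_of_pos (by positivity : (0:ℝ) < r * R ^ 2)]
              have : 2 * |deriv b (r ^ 2 / R ^ 2)| / (r * R ^ 2) ≤ 2 * B₁ / (r * R ^ 2) := by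
                gcongr; exact abs_le.2 hb2
              refine this.trans ?_
              gcongr
            · rw [abs_div, abs_mul, abs_mul, abs_of_pos (by norm_num : (0:ℝ) < 4), abs_of_pos hr0,
                abs_of_pos (by positivity : (0:ℝ) < R ^ 4)]
              gcongr; exact abs_le.2 hb3
        _ = (4 * B₁ + 4 * B₂) * R⁻¹ ^ 3 := by field_simp; ring
    · rw [hlap_far r h', abs_zero]; positivity
  · exact fun z hz => hlap_far ‖z‖ hz
  · -- flux identity
    intro ρ₁ h1 h2
    have hρ0 : 0 < ρ₁ := hε.trans h1
    set lapr : ℝ → ℝ := fun r => 4 * q₂ (r ^ 2) * r ^ 2 + 6 * q₁ (r ^ 2) with hlapr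
    set f : ℝ → ℝ := fun r => if r ≤ ρ₁ then lapr r else 0 with hf
    have hlapr_cont : Continuous lapr := by simp only [hlapr]; fun_prop
    have step1 : ∫ z in closedBall (0 : EuclideanSpace ℝ (Fin 3)) ρ₁, lapr ‖z‖ =
        ∫ z : EuclideanSpace ℝ (Fin 3), f ‖z‖ := by
      rw [← integral_indicator measurableSet_closedBall]
      congr 1
      funext z
      simp only [Set.indicator, mem_closedBall_zero_iff, hf]
    have step2 : ∫ r in Ioi (0:ℝ), r ^ 2 * f r = ∫ r in (0:ℝ)..ρ₁, r ^ 2 * lapr r := by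
      have : (fun r => r ^ 2 * f r) = (Iic ρ₁).indicator fun r => r ^ 2 * lapr r := by
        funext r
        simp only [hf, Set.indicator, mem_Iic]
        split_ifs <;> simp
      rw [this, setIntegral_indicator measurableSet_Iic, Ioi_inter_Iic,
        intervalIntegral.integral_of_le hρ0.le]
    have step3 : ∫ r in (0:ℝ)..ρ₁, r ^ 2 * lapr r = 2 * ρ₁ ^ 3 * q₁ (ρ₁ ^ 2) - 2 * 0 ^ 3 * q₁ (0 ^ 2) := by
      apply intervalIntegral.integral_eq_sub_of_hasDerivAt (f := fun r => 2 * r ^ 3 * q₁ (r ^ 2))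
      · intro r _
        have hc0 := (hq₁_deriv (r ^ 2)).comp r (hasDerivAt_pow 2 r)
        have hc : HasDerivAt (fun r : ℝ => q₁ (r ^ 2)) (q₂ (r ^ 2) * (↑(2:ℕ) * r ^ (2 - 1))) r :=
          hc0
        have hp : HasDerivAt (fun r : ℝ => 2 * r ^ 3) (2 * (↑(3:ℕ) * r ^ (3 - 1))) r :=
          (hasDerivAt_pow 3 r).const_mul 2
        refine (hp.mul hc).congr_deriv ?_
        simp only [hlapr]
        push_cast
        ring
      · exact ((continuous_pow 2).mul hlapr_cont).intervalIntegrable _ _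
    have hq₁ρ : q₁ (ρ₁ ^ 2) = -1 / (2 * ρ₁ ^ 3) := by
      obtain ⟨hb1, hb2, -⟩ := hb_in ρ₁ hρ0.le h2
      rw [hq₁_out ρ₁ h1, hb1, hb2]; ring
    show ∫ z in closedBall (0 : EuclideanSpace ℝ (Fin 3)) ρ₁, lapr ‖z‖ = -4 * π
    rw [step1, integral_radial_fin_three f, step2, step3, hq₁ρ]
    field_simp
    ring
  · -- `L¹` bound
    set fq : ℝ → ℝ := fun r => q (r ^ 2) with hfq
    have hrad : ∫ z, F z = 4 * π * ∫ r in Ioi (0:ℝ), r ^ 2 * fq r :=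
      integral_radial_fin_three fq
    have hint1 : IntegrableOn (fun r : ℝ => r ^ 2 * fq r) (Ioi 0) := by
      have h := (integrable_fun_norm_addHaar (volume : Measure (EuclideanSpace ℝ (Fin 3)))
        (f := fq)).1 hF_int
      simp only [finrank_euclideanSpace_fin, smul_eq_mul] at h
      have : (3 - 1 : ℕ) = 2 := by norm_num
      simpa [this] using h
    set g₂ : ℝ → ℝ := (Iic R).indicator fun r => Real.sqrt 2 * r with hg₂
    have hint2 : IntegrableOn g₂ (Ioi 0) := by
      rw [hg₂, integrableOn_indicator_iff measurableSet_Iic, Iic_inter_Ioi]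
      exact ((continuous_const.mul continuous_id).integrableOn_Icc).mono_set Ioc_subset_Icc_self
    have hle : ∀ r ∈ Ioi (0:ℝ), r ^ 2 * fq r ≤ g₂ r := by
      intro r hr
      have hr0 : 0 < r := hr
      simp only [hg₂, Set.indicator, mem_Iic, hfq]
      split_ifs with h
      · rcases le_or_gt r ε with h' | h'
        · rw [hq_in r hr0.le h']
          have h1 : ε⁻¹ * a (r ^ 2 / ε ^ 2) ≤ ε⁻¹ * Real.sqrt 2 :=
            mul_le_mul_of_nonneg_left (ha_le _) (inv_nonneg.2 hε.le)
          have h2 : r * ε⁻¹ ≤ 1 := by rw [mul_inv_le_iff₀ hε]; linarith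
          calc r ^ 2 * (ε⁻¹ * a (r ^ 2 / ε ^ 2)) ≤ r ^ 2 * (ε⁻¹ * Real.sqrt 2) := by gcongr
            _ = (r * ε⁻¹) * (Real.sqrt 2 * r) := by ring
            _ ≤ 1 * (Real.sqrt 2 * r) := by gcongr
            _ = Real.sqrt 2 * r := one_mul _
        · rw [hq_out r h'.le]
          have h1 : (1:ℝ) ≤ Real.sqrt 2 := by
            rw [show (1:ℝ) = Real.sqrt 1 by simp]
            exact Real.sqrt_le_sqrt (by norm_num)
          calc r ^ 2 * (r⁻¹ * b (r ^ 2 / R ^ 2)) = r * b (r ^ 2 / R ^ 2) := by field_simp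
            _ ≤ r * 1 := by gcongr; exact hb_le _
            _ ≤ Real.sqrt 2 * r := by nlinarith
      · push Not at h
        rw [show q (r ^ 2) = 0 from by simp only [hq, hb_out r h.le, mul_zero]]
        simp
    have hmono : ∫ r in Ioi (0:ℝ), r ^ 2 * fq r ≤ ∫ r in Ioi (0:ℝ), g₂ r :=
      setIntegral_mono_on hint1 hint2 measurableSet_Ioi hle
    have hg₂int : ∫ r in Ioi (0:ℝ), g₂ r = Real.sqrt 2 * (R ^ 2 / 2) := by
      rw [hg₂, setIntegral_indicator measurableSet_Iic, Ioi_inter_Iic,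
        ← intervalIntegral.integral_of_le hR0.le, intervalIntegral.integral_const_mul, integral_id]
      ring
    rw [hrad]
    calc 4 * π * ∫ r in Ioi (0:ℝ), r ^ 2 * fq r ≤ 4 * π * (Real.sqrt 2 * (R ^ 2 / 2)) := by
          rw [← hg₂int]; gcongr
      _ = 2 * Real.sqrt 2 * π * R ^ 2 := by ring

end VortexFilament

end Literature.Analysis.FluidPDE
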